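import Mathlib.LinearAlgebra.Matrix.Permutation
import Mathlib.Dynamics.PeriodicPts.Lemmas
import Literature.Computability.AlgebraicComplexity.FermionantCompletenessProofs
import Literature.Computability.AlgebraicComplexity.HamiltonianCycleVNP

/-!
# Route `FermionicJet`, item `JetsInVNP` (stmt-ValiantsHypothesis-5344) — helper file 1/3:
# cycle lengths, the count `∑ᵢ 1/ℓ(i) = c(σ)`, and powers of permutation matrices

Support lemmas (no new definitions) for the `VNP`-membership of the cycle jets
`J_{n,r} = ∑_σ sgn σ · binom(c(σ), r) ∏ᵢ X_{σ i, i}` (`cycleJetPoly`, `FermionicPencil.lean`),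
`c(σ) = Equiv.Perm.numCycles σ` the number of cycles INCLUDING fixed points. The `VP` witness of
the main file computes `c(σ)` from the permutation matrix `P_σ` as
`∑ᵢ 1/ℓ(i)`, `ℓ(i)` the length of the cycle through `i`, and `1/ℓ(i)` as the first-return sum
`∑_m (1/m) [σ^m i = i] ∏_{1 ≤ l < m} (1 - [σ^l i = i])` whose indicators are diagonal entries of
powers of `P_σ`. This file supplies the combinatorics:

* `ℓ(i) = Function.minimalPeriod σ i` is the size of the `SameCycle` class of `i`
  (`card_filter_sameCycle_eq_minimalPeriod`), `σ^m i = i ↔ ℓ(i) ∣ m`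
  (`pow_apply_eq_self_iff_minimalPeriod_dvd`);
* `∑ᵢ 1/ℓ(i) = c(σ)` in any field of characteristic zero (`sum_inv_minimalPeriod`; the cycles
  are the `SameCycle` classes, `DeRugyAltherre.numCycles_eq_numOrbits` of
  `FermionantCompletenessProofs.lean`);
* the first-return sum picks out `m = ℓ(i)` (`sum_firstReturn`);
* the `0/1` matrix of `permGraph σ` (`HamiltonianCycleVNP.lean`) is Mathlib's `σ.permMatrix`,
  `(σ^m).permMatrix = σ.permMatrix ^ m`, and `(P_σ^m)_{ii} = [σ^m i = i]`.

References: P. Bürgisser, *Completeness and Reduction in Algebraic Complexity Theory*, Springer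
2000, Def. 2.5 (the format of `VNP`); BCS 1997, Prop. (21.15) (permutation-matrix recogniser).
-/

-- single-conjunct layout: Sub = Summit, duplicated namespace component intended
set_option linter.dupNamespace false

namespace Summit.ValiantsHypothesis.ValiantsHypothesis.Theorems.FermionicJetJetsInVNP

open Literature.Computability.AlgebraicComplexity Equiv Finset

universe u

/-! ### Cycle lengths as minimal periods -/

section Cycles

variable {α : Type u} [Fintype α] [DecidableEq α]

omit [DecidableEq α] in
/-- Every point of a finite type is periodic under a permutation, so its minimal period is
positive. [folklore] -/
theorem minimalPeriod_pos_perm (σ : Perm α) (x : α) : 0 < Function.minimalPeriod σ x :=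
  Function.minimalPeriod_pos_of_mem_periodicPts (σ.injective.mem_periodicPts x)

/-- The cycle through `x` is `{x, σ x, …, σ^{p-1} x}`, `p` the minimal period. [folklore] -/
theorem filter_sameCycle_eq_image (σ : Perm α) (x : α) :
    (Finset.univ.filter fun y => Equiv.Perm.SameCycle σ x y) =
      (Finset.range (Function.minimalPeriod σ x)).image fun m => (σ : α → α)^[m] x := by
  ext y
  simp only [Finset.mem_filter, Finset.mem_univ, true_and, Finset.mem_image, Finset.mem_range]
  constructor
  · intro h
    obtain ⟨i, hi⟩ := h.exists_nat_pow_eq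
    refine ⟨i % Function.minimalPeriod σ x, Nat.mod_lt _ (minimalPeriod_pos_perm σ x), ?_⟩
    rw [Function.iterate_mod_minimalPeriod_eq, Equiv.Perm.iterate_eq_pow, hi]
  · rintro ⟨m, -, rfl⟩
    rw [Equiv.Perm.iterate_eq_pow]
    exact Equiv.Perm.sameCycle_pow_right.2 (Equiv.Perm.SameCycle.refl σ x)

/-- **The length `ℓ(x)` of the cycle through `x`** (number of points on the same cycle, `1` for a
fixed point) **is the minimal period of `x` under `σ`.** [folklore] -/
theorem card_filter_sameCycle_eq_minimalPeriod (σ : Perm α) (x : α) :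
    (Finset.univ.filter fun y => Equiv.Perm.SameCycle σ x y).card = Function.minimalPeriod σ x := by
  rw [filter_sameCycle_eq_image, Finset.card_image_of_injOn, Finset.card_range]
  rw [Finset.coe_range]
  exact Function.iterate_injOn_Iio_minimalPeriod

omit [Fintype α] [DecidableEq α] in
/-- **`σ^m x = x` iff `ℓ(x) ∣ m`.** [folklore] -/
theorem pow_apply_eq_self_iff_minimalPeriod_dvd (σ : Perm α) (x : α) (m : ℕ) :
    (σ ^ m) x = x ↔ Function.minimalPeriod σ x ∣ m := by
  rw [← Function.isPeriodicPt_iff_minimalPeriod_dvd, Function.IsPeriodicPt, Function.IsFixedPt,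
    Equiv.Perm.iterate_eq_pow]

/-- **`∑ₓ 1/ℓ(x)` is the number of cycles, fixed points included** (each cycle of length `ℓ`
contributes `ℓ · (1/ℓ) = 1`; the cycles are the `SameCycle` classes, counted by
`DeRugyAltherre.numOrbits = Equiv.Perm.numCycles`). [folklore] -/
theorem sum_inv_minimalPeriod (K : Type*) [Field K] [CharZero K] (σ : Perm α) :
    ∑ x, ((Function.minimalPeriod σ x : K))⁻¹ = (σ.numCycles : K) := by
  classical
  rw [DeRugyAltherre.numCycles_eq_numOrbits, DeRugyAltherre.numOrbits, ← Finset.card_univ,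
    Finset.card_eq_sum_ones, Nat.cast_sum, Nat.cast_one,
    ← Finset.sum_fiberwise Finset.univ (DeRugyAltherre.orbitOf σ)
      fun x => ((Function.minimalPeriod σ x : K))⁻¹]
  refine Finset.sum_congr rfl fun q _ => ?_
  have hfib : ∀ x ∈ Finset.univ.filter (fun x => DeRugyAltherre.orbitOf σ x = q),
      ((Function.minimalPeriod σ x : K))⁻¹ =
        ((Finset.univ.filter fun x => DeRugyAltherre.orbitOf σ x = q).card : K)⁻¹ := by
    intro x hx
    simp only [Finset.mem_filter, Finset.mem_univ, true_and] at hx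
    rw [← card_filter_sameCycle_eq_minimalPeriod]
    congr 3
    ext y
    simp only [Finset.mem_filter, Finset.mem_univ, true_and]
    rw [← hx, DeRugyAltherre.orbitOf_eq_orbitOf_iff]
    exact ⟨fun h => h.symm, fun h => h.symm⟩
  rw [Finset.sum_congr rfl hfib, Finset.sum_const, nsmul_eq_mul, mul_inv_cancel₀]
  obtain ⟨x, hx⟩ := DeRugyAltherre.orbitOf_surjective σ q
  rw [Nat.cast_ne_zero, ← pos_iff_ne_zero, Finset.card_pos]
  exact ⟨x, by simp [hx]⟩

/-- **The first-return sum.** For weights `w`, the sum over `1 ≤ m ≤ card α` of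
`w m · [σ^m x = x] · ∏_{1 ≤ l < m} (1 - [σ^l x = x])` picks out the single term `m = ℓ(x)`
(the first return of `x` to itself). [folklore] -/
theorem sum_firstReturn {R : Type*} [CommRing R] (σ : Perm α) (x : α) (w : ℕ → R) :
    ∑ m ∈ Finset.Icc 1 (Fintype.card α), w m * (if (σ ^ m) x = x then 1 else 0) *
        ∏ l ∈ Finset.Ico 1 m, (1 - if (σ ^ l) x = x then (1 : R) else 0) =
      w (Function.minimalPeriod σ x) := by
  have hpos := minimalPeriod_pos_perm σ x
  rw [Finset.sum_eq_single_of_mem (Function.minimalPeriod σ x)]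
  · rw [if_pos ((pow_apply_eq_self_iff_minimalPeriod_dvd σ x _).2 dvd_rfl), mul_one,
      Finset.prod_eq_one, mul_one]
    intro l hl
    rw [Finset.mem_Ico] at hl
    rw [if_neg, sub_zero]
    rw [pow_apply_eq_self_iff_minimalPeriod_dvd]
    exact Nat.not_dvd_of_pos_of_lt hl.1 hl.2
  · exact Finset.mem_Icc.2 ⟨hpos, Function.minimalPeriod_le_card⟩
  · intro m hm hne
    rw [Finset.mem_Icc] at hm
    by_cases hdvd : Function.minimalPeriod σ x ∣ m
    · have hlt : Function.minimalPeriod σ x < m :=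
        lt_of_le_of_ne (Nat.le_of_dvd hm.1 hdvd) (Ne.symm hne)
      rw [Finset.prod_eq_zero (i := Function.minimalPeriod σ x) (Finset.mem_Ico.2 ⟨hpos, hlt⟩),
        mul_zero]
      rw [if_pos ((pow_apply_eq_self_iff_minimalPeriod_dvd σ x _).2 dvd_rfl), sub_self]
    · rw [if_neg (mt (pow_apply_eq_self_iff_minimalPeriod_dvd σ x m).1 hdvd), mul_zero, zero_mul]

end Cycles

/-! ### Permutation matrices: entries, powers, return indicators -/

section PermMatrix

variable {R : Type*} [CommRing R] {N : ℕ}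

/-- Entries of Mathlib's permutation matrix: `(P_σ)_{ab} = [σ a = b]`. [folklore] -/
theorem permMatrix_apply' (σ : Perm (Fin N)) (a b : Fin N) :
    σ.permMatrix R a b = if σ a = b then 1 else 0 := by
  simp [Equiv.Perm.permMatrix, PEquiv.toMatrix_apply, eq_comm]

/-- The `0/1` matrix of `permGraph σ` (entry `[σ t = i]`, `HamiltonianCycleVNP.lean`) is Mathlib's
permutation matrix `σ.permMatrix`. [folklore] -/
theorem of_permGraph_eq_permMatrix (σ : Perm (Fin N)) :
    (Matrix.of fun t i => if permGraph σ (t, i) then (1 : R) else 0) = σ.permMatrix R := by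
  refine Matrix.ext fun t i => ?_
  rw [permMatrix_apply', Matrix.of_apply]
  simp [permGraph]

/-- Powers of permutations go to powers of permutation matrices. [folklore] -/
theorem permMatrix_pow (σ : Perm (Fin N)) (m : ℕ) :
    (σ ^ m).permMatrix R = (σ.permMatrix R) ^ m := by
  induction m with
  | zero => simp
  | succ m ih => rw [pow_succ, Matrix.permMatrix_mul, ih, ← pow_succ']

/-- **Return indicator**: the diagonal entry `(P_σ^m)_{ii}` is `[σ^m i = i]`. [folklore] -/
theorem permMatrix_pow_apply_self (σ : Perm (Fin N)) (m : ℕ) (i : Fin N) :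
    ((σ.permMatrix R) ^ m) i i = if (σ ^ m) i = i then 1 else 0 := by
  rw [← permMatrix_pow, permMatrix_apply']

/-- A ring homomorphism taking a matrix `M` entrywise to `P_σ` takes `(M^m)_{ii}` to
`[σ^m i = i]`. [folklore] -/
theorem map_pow_apply_self_of_map_eq {S : Type*} [CommRing S] (f : S →+* R)
    (M : Matrix (Fin N) (Fin N) S) (σ : Perm (Fin N))
    (hM : ∀ a b, f (M a b) = if σ a = b then 1 else 0) (m : ℕ) (i : Fin N) :
    f ((M ^ m) i i) = if (σ ^ m) i = i then 1 else 0 := by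
  have h : f.mapMatrix M = σ.permMatrix R :=
    Matrix.ext fun a b => by rw [RingHom.mapMatrix_apply, Matrix.map_apply, hM, permMatrix_apply']
  rw [← permMatrix_pow_apply_self, ← h, ← map_pow]
  rfl

end PermMatrix

end Summit.ValiantsHypothesis.ValiantsHypothesis.Theorems.FermionicJetJetsInVNP
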